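import Summits.AtomisticToContinuum.Crystallization.Theorems.FreeSplittingCertificatesStrictSplittingRuleTorusModel442Defs

/-!
# The joint (r6) sitewise LMI on the hcp torus 4×4×2, parity A — MODEL-LEVEL THEOREM (finite model of H12⋆)

Route `FreeSplittingCertificates`, crux `StrictSplittingRule` (stmt-AtomisticToContinuum-12560); unit b2b-freesplit-B (block 2b,
PART B, gen 1).  **VALUE = a kernel-accepted (computational lane) theorem about a FINITE model — NOT summit progress.**  It does
not prove the registered stub `stub_coreJointCoercive` (an infinite-dimensional covariant LMI).

The model (torus, hcp geometry in the scaled rational frame, LJ weights, least-squares co-rotation, supply / demand / readout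
form / transfers — verbatim the terms of `CoreJointSiteIneq`) is DEFINED IN LEAN in `…TorusModel442Defs.lean`; read its header.
Here: the certificate for the reference A site `siteA` and the two theorems

* `jointLMI442A : ∀ u, demand siteA u + margin442 · normSqG u ≤ supply siteA u + transfer siteA u + meanProj u`
  (`margin442 = 39101/2²⁰ = 0.0373`, identity-normalised Cartesian norm; `meanProj` = the translation projector term),
* `jointLMI442A_zeroMean` : the same without `meanProj` for zero-mean fields (`Σ_q u_(q,c) = 0`, `c = 0,1,2`).

Proof = `evalQ_nonneg_of_certDD` (…TorusQForm.lean: the term-list form equals `uᵀ·G·u` for the Gram matrix ASSEMBLED IN LEAN,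
proved) + `certA_valid`, ONE `native_decide` of the trusted rounded-Gram predicate `PSD.IsGramCertDD`
(`Literature/Computation/Certificates/PosSemidef.lean`) on `matA` with the rounded `LDLᵀ` factor `factA` computed in Lean
(residual `= 10⁻³·1 +` 40-bit rounding noise, diagonally dominant).  Regime: COMPUTATIONAL (`native_decide`, axiom
`Lean.ofReduceBool`; the assembly — 8.7·10⁶ exact rational updates — and the 192-dimensional elimination exceed the kernel;
≈ 110 s in the evaluator).  Cross-checks: HOME run/shared/lean/b2b/freesplit-r2/CERT.md §9.
-/

namespace Summit.AtomisticToContinuum.Crystallization.Theorems.StrictSplittingRuleTorusLMI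

open Literature.Computation.Certificates

/-- **Certificate, parity A**: `matA ⪰ 0` by the trusted rounded-Gram check `PSD.IsGramCertDD` (factor `factA` computed in
Lean; residual `= 10⁻³·1 +` rounding noise, diagonally dominant).  COMPUTATIONAL (`native_decide`). -/
theorem certA_valid : PSD.IsGramCertDD matA (vecOfArray 192 factA.1) (matrixOfArrays 192 192 factA.2) := by
  native_decide

/-- **The joint (r6) sitewise LMI at the A site of the 4×4×2 hcp torus, margin `m = 39101/2²⁰`**: for EVERY displacement
field `u`, `D_p(u) + m‖u‖²_G ≤ S_p(u) + T_p(u) + meanProj(u)` (`meanProj` = translation projector, zero on zero-mean fields).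
Finite model of H12⋆ (`CoreJointCoercive`), not the stub itself. -/
theorem jointLMI442A (u : Fin 192 → ℚ) :
    demand siteA u + margin442 * normSqG u ≤ supply siteA u + transfer siteA u + meanProj u := by
  have h := evalQ_nonneg_of_certDD (ts := certTerms siteA margin442) rfl certA_valid u
  rw [evalQ_certTerms] at h
  linarith

/-- **Zero-mean form, A site**: for every periodic displacement field with `Σ_q u_(q,c) = 0` (`c = 0,1,2`),
`D_p(u) + m‖u‖²_G ≤ S_p(u) + T_p(u)` — the sitewise joint inequality with margin `m` (cf. CERT.md §1 "CLAIM CERTIFIED"). -/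
theorem jointLMI442A_zeroMean (u : Fin 192 → ℚ) (h0 : ∀ c : Fin 3, (sumF c).eval u = 0) :
    demand siteA u + margin442 * normSqG u ≤ supply siteA u + transfer siteA u := by
  have h := jointLMI442A u
  rw [meanProj_eq_zero h0, add_zero] at h
  exact h

end Summit.AtomisticToContinuum.Crystallization.Theorems.StrictSplittingRuleTorusLMI
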